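import Summits.BirchSwinnertonDyer.Rank1Residual.ManinAdditive.TowerRigidity

/-!
# E-an-142, step (5.4) CLASS-INDEPENDENCE: every level of a TV-rigid tower pattern is constant on the units
# (cell bsd-f2-manin, analytic lens g30, PROOFS-an-72 §5.4; the one remaining stub `stub_classIndep` of an's TowerRigiditySkeleton-an-g30;
# work split with the lead p1 g10, who ports (5.1)–(5.3), (5.5) and the composition to `TowerExtension.MultiHubImpliesRigidity`)

Summit `BirchSwinnertonDyer`, route `ManinLocalTwoThree`, cruxes C3 `ManinPrimeToThreeAtNine` (stmt-BirchSwinnertonDyer-22968) / C2 `ManinOddAtFour`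
(stmt-…-22967).  Data: a pattern `g : ℕ → ℤ → ℤ/p` (think `g n r = G(r/qⁿ)`) with (P0) `g 0 = 0`, (P1) period `qⁿ` at level `n`, (P2) `g (n+1) (q r) = g n r`,
(EV) evenness, the RESOLUTION `hres` (period `qˢ` on units from level `s` on; an (5.0), p1's `tv_resolution`), and the INTEGER MULTI-HUB EQUATION `hMHint`
(an (5.3) `fine_multiHub`, binders verbatim): for a deep row `γ = (A B; N qᵉ k, D) ∈ SL₂(ℤ)`, `D ≡ 1 (mod Nk)`, `Nk·ρ ≡ 1 (mod q^L)`: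
`g e ρ − g e (Dρ) = g e ((A−1)/(Nk)) − g e ((1−D)/(Nk))`.  CONCLUSION (5.4): with LEMMA MH `MultiHubRigid q p` (a tree theorem:
`…Theorems.ManinLocalTwoThree.multiHubRigid_holds`), every level `g e` is constant on the integers prime to `q`.

PROOF (a valuation-free arrangement of an's (5.4)).  Induction on `e`; level `0` is (P0).  KEY(e): for units `h′ ≡ h (mod q)` with `q² ∤ h′ − h`,
`g e h′ = g e h` — take `k ≥ 1` with `Nkh ≡ 1 (mod q^{min(e,s)})`, the deep row with `D = 1 + Nk·q·u`, `u = (h′−h)/q` (so `Dρ ≡ h′`), where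
`(1−D)/(Nk) = −qu` and `(A−1)/(Nk) = −Aqu + Bqᵉ` are `q` times units: by (P2) the right side of the multi-hub equation lives at level `e − 1` and
vanishes by induction ((P0) when `e = 1`).  Two KEY steps (through `h(1+q)`) show that `g e` on units depends only on the residue mod `q`, so
`Ḡ(x̄) := g e (x̄.val)` is an even function on `ℤ/q`; the deep row with `D = 1 + Nk(D̄.val − 1)ρ` turns the multi-hub equation into an's relation (★)
for `Ḡ`, and `MultiHubRigid q p` makes `Ḡ` constant on `(ℤ/q)ˣ`.

* this file: the row arithmetic — `exists_pos_nat_inverse`, `tv_periodZ`, `tv_resMin`, `tv_res_of_modEq`, `tv_deepRow` (the deep row fed to the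
  integer multi-hub equation), `tv_exists_hub` (hubs `k, ρ`), `tv_key` (KEY), `tv_modq` (residue-mod-`q` dependence);
* sibling `…TVClassIndep`: `tv_classIndep_succ`, `tv_classIndep` — the statement above (`hMH : TowerExtension.MultiHubRigid q p` BY NAME).

HONEST FRAMING: one step of the Lean proof of E-an-142 `TVPatternRigidity`; nothing about Manin's conjecture or BSD is proved here.
-/

set_option linter.dupNamespace false
set_option autoImplicit false

namespace Summit.BirchSwinnertonDyer.BirchSwinnertonDyer.Theorems.ManinLocalTwoThree

open Summit.BirchSwinnertonDyer.Rank1Residual.ManinAdditive.TowerExtension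
open Matrix
open scoped MatrixGroups

section ClassIndep

/-- A positive inverse modulo `Q > 1`. -/
theorem exists_pos_nat_inverse {Q a : ℤ} (hQ : 1 < Q) (ha : IsCoprime a Q) : ∃ k : ℕ, 0 < k ∧ a * k ≡ 1 [ZMOD Q] := by
  obtain ⟨u, v, huv⟩ := ha
  have hQ0 : 0 < Q := by omega
  refine ⟨(u % Q).toNat, ?_, ?_⟩
  · rw [Nat.pos_iff_ne_zero]
    intro h0
    have hnn : 0 ≤ u % Q := Int.emod_nonneg _ hQ0.ne'
    have hu0 : u % Q = 0 := by
      have := Int.toNat_of_nonneg hnn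
      rw [h0] at this
      exact_mod_cast this.symm
    obtain ⟨c, hc⟩ := Int.dvd_of_emod_eq_zero hu0
    have : Q ∣ 1 := ⟨c * a + v, by rw [← huv, hc]; ring⟩
    have := Int.le_of_dvd one_pos this
    omega
  · rw [Int.toNat_of_nonneg (Int.emod_nonneg _ hQ0.ne')]
    have h1 : a * (u % Q) ≡ a * u [ZMOD Q] := (Int.mod_modEq u Q).mul_left a
    refine h1.trans ?_
    rw [Int.modEq_iff_dvd]
    exact ⟨v, by linear_combination -huv⟩

variable {N q p s : ℕ} {g : ℕ → ℤ → ZMod p}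

/-- (P1) iterated: period `t·qⁿ`, `t ∈ ℤ`. -/
theorem tv_periodZ (period : ∀ n r, g n (r + (q : ℤ) ^ n) = g n r) (n : ℕ) (r t : ℤ) :
    g n (r + t * (q : ℤ) ^ n) = g n r := by
  induction t using Int.induction_on with
  | zero => simp
  | succ i ih => rw [add_mul, one_mul, ← add_assoc, period, ih]
  | pred i ih =>
    have h := period n (r + (-(i : ℤ) - 1) * (q : ℤ) ^ n)
    rw [show r + (-(i : ℤ) - 1) * (q : ℤ) ^ n + (q : ℤ) ^ n = r + -(i : ℤ) * (q : ℤ) ^ n by ring] at h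
    rw [← h]
    exact ih

/-- Resolution at every level with modulus `q^{min(e,s)}`. -/
theorem tv_resMin (period : ∀ n r, g n (r + (q : ℤ) ^ n) = g n r)
    (hres : ∀ (n : ℕ) (r t : ℤ), s ≤ n → IsCoprime r (q : ℤ) → g n (r + t * (q : ℤ) ^ s) = g n r)
    (e : ℕ) (r t : ℤ) (hr : IsCoprime r (q : ℤ)) : g e (r + t * (q : ℤ) ^ (min e s)) = g e r := by
  rcases le_or_gt s e with h | h
  · rw [min_eq_right h]; exact hres e r t h hr
  · rw [min_eq_left h.le]; exact tv_periodZ period e r t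

/-- Resolution in congruence form: `r′ ≡ r (mod q^{min(e,s)})`, `r` a unit ⟹ `g e r′ = g e r`. -/
theorem tv_res_of_modEq (period : ∀ n r, g n (r + (q : ℤ) ^ n) = g n r)
    (hres : ∀ (n : ℕ) (r t : ℤ), s ≤ n → IsCoprime r (q : ℤ) → g n (r + t * (q : ℤ) ^ s) = g n r)
    (e : ℕ) {r r' : ℤ} (hr : IsCoprime r (q : ℤ)) (h : r' ≡ r [ZMOD (q : ℤ) ^ (min e s)]) : g e r' = g e r := by
  obtain ⟨t, ht⟩ := (Int.modEq_iff_dvd.mp h.symm)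
  rw [show r' = r + t * (q : ℤ) ^ (min e s) by linear_combination ht]
  exact tv_resMin period hres e r t hr

/-- The deep row: from a unit `h`, a target residue and the side data, an instance of the integer multi-hub equation.  Given `k ≥ 1` prime to `q`,
`z : ℤ`, `D = 1 + Nk·z` prime to `q`, there are `A, B` with `γ = (A B; N qᵉ k, D) ∈ SL₂(ℤ)`, and the multi-hub equation reads
`g e ρ − g e (Dρ) = g e (−A z + B qᵉ) − g e (−z)` for every `ρ` with `Nkρ ≡ 1 (mod q^L)`, `L ≥ e + φ(Nk)s`. -/
theorem tv_deepRow
    (hMHint : ∀ (γ : SL(2, ℤ)) (k e L : ℕ), 0 < k → Nat.Coprime k q → 1 ≤ e → e + Nat.totient (N * k) * s ≤ L →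
      ∀ ρ : ℤ, ((N * k : ℕ) : ℤ) * ρ ≡ 1 [ZMOD (q : ℤ) ^ L] →
      (γ : Matrix (Fin 2) (Fin 2) ℤ) 1 0 = ((N * q ^ e * k : ℕ) : ℤ) →
      (γ : Matrix (Fin 2) (Fin 2) ℤ) 1 1 ≡ 1 [ZMOD ((N * k : ℕ) : ℤ)] →
      ∀ x y : ℤ, ((N * k : ℕ) : ℤ) * x = 1 - (γ : Matrix (Fin 2) (Fin 2) ℤ) 1 1 →
        ((N * k : ℕ) : ℤ) * y = (γ : Matrix (Fin 2) (Fin 2) ℤ) 0 0 - 1 →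
        g e ρ - g e ((γ : Matrix (Fin 2) (Fin 2) ℤ) 1 1 * ρ) = g e y - g e x)
    {k e : ℕ} (hk : 0 < k) (hkq : Nat.Coprime k q) (he : 1 ≤ e) {z : ℤ}
    (hDq : IsCoprime (1 + ((N * k : ℕ) : ℤ) * z) (q : ℤ)) {ρ : ℤ}
    (hρ : ((N * k : ℕ) : ℤ) * ρ ≡ 1 [ZMOD (q : ℤ) ^ (e + Nat.totient (N * k) * s)]) :
    ∃ A B : ℤ, A * (1 + ((N * k : ℕ) : ℤ) * z) - B * ((N * q ^ e * k : ℕ) : ℤ) = 1 ∧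
      g e ρ - g e ((1 + ((N * k : ℕ) : ℤ) * z) * ρ) = g e (-A * z + B * (q : ℤ) ^ e) - g e (-z) := by
  set D : ℤ := 1 + ((N * k : ℕ) : ℤ) * z with hDdef
  set C : ℤ := ((N * q ^ e * k : ℕ) : ℤ) with hCdef
  -- `gcd(C, D) = 1`
  have hcop : IsCoprime D C := by
    rw [hCdef, show ((N * q ^ e * k : ℕ) : ℤ) = ((N * k : ℕ) : ℤ) * (q : ℤ) ^ e by push_cast; ring]
    refine IsCoprime.mul_right ?_ (IsCoprime.pow_right hDq)
    refine ⟨1, -z, ?_⟩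
    rw [hDdef]; ring
  obtain ⟨A, B', hAB⟩ := hcop
  refine ⟨A, -B', by linear_combination hAB, ?_⟩
  let γ : SL(2, ℤ) := ⟨!![A, -B'; C, D], by rw [Matrix.det_fin_two_of]; linear_combination hAB⟩
  have h00 : (γ : Matrix (Fin 2) (Fin 2) ℤ) 0 0 = A := rfl
  have h10 : (γ : Matrix (Fin 2) (Fin 2) ℤ) 1 0 = C := rfl
  have h11 : (γ : Matrix (Fin 2) (Fin 2) ℤ) 1 1 = D := rfl
  have hDmod : (γ : Matrix (Fin 2) (Fin 2) ℤ) 1 1 ≡ 1 [ZMOD ((N * k : ℕ) : ℤ)] := by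
    rw [h11, Int.modEq_iff_dvd]
    exact ⟨-z, by rw [hDdef]; ring⟩
  have hx : ((N * k : ℕ) : ℤ) * (-z) = 1 - (γ : Matrix (Fin 2) (Fin 2) ℤ) 1 1 := by rw [h11, hDdef]; ring
  have hy : ((N * k : ℕ) : ℤ) * (-A * z + -B' * (q : ℤ) ^ e) = (γ : Matrix (Fin 2) (Fin 2) ℤ) 0 0 - 1 := by
    rw [h00]
    have hC' : C = ((N * k : ℕ) : ℤ) * (q : ℤ) ^ e := by rw [hCdef]; push_cast; ring
    rw [hC', hDdef] at hAB
    linear_combination -hAB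
  have h := hMHint γ k e (e + Nat.totient (N * k) * s) hk hkq he le_rfl ρ hρ h10 hDmod (-z) (-A * z + -B' * (q : ℤ) ^ e) hx hy
  rw [h11] at h
  convert h using 2

/-- Hubs: for a unit `h` and a level `E` (`min(E,s) ≥ 1`) there are `k ≥ 1` prime to `q` and `ρ` with `Nk·ρ ≡ 1 (mod q^L)`, `L = E + φ(Nk)s`,
and `ρ ≡ h`, `Nkρ ≡ 1 (mod q^{min(E,s)})`. -/
theorem tv_exists_hub (hq : q.Prime) (hqN : Nat.Coprime q N) (E : ℕ) (hm : 1 ≤ min E s) {h : ℤ} (hh : IsCoprime h (q : ℤ)) :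
    ∃ (k : ℕ) (ρ : ℤ), 0 < k ∧ Nat.Coprime k q ∧
      ((N * k : ℕ) : ℤ) * ρ ≡ 1 [ZMOD (q : ℤ) ^ (E + Nat.totient (N * k) * s)] ∧
      ((N * k : ℕ) : ℤ) * ρ ≡ 1 [ZMOD (q : ℤ) ^ (min E s)] ∧
      ρ ≡ h [ZMOD (q : ℤ) ^ (min E s)] := by
  set m := min E s with hmdef
  have hq2 : (2 : ℤ) ≤ q := by exact_mod_cast hq.two_le
  have hQ : (1 : ℤ) < (q : ℤ) ^ m := by
    calc (1 : ℤ) < q := by omega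
      _ = (q : ℤ) ^ 1 := (pow_one _).symm
      _ ≤ (q : ℤ) ^ m := pow_le_pow_right₀ (by omega) hm
  have hNq : IsCoprime (N : ℤ) (q : ℤ) := Nat.isCoprime_iff_coprime.mpr hqN.symm
  have hNh : IsCoprime ((N : ℤ) * h) ((q : ℤ) ^ m) := (IsCoprime.mul_left hNq hh).pow_right
  obtain ⟨k, hk0, hk1⟩ := exists_pos_nat_inverse hQ hNh
  -- `k` is prime to `q`
  have hkq' : IsCoprime (k : ℤ) (q : ℤ) := by
    obtain ⟨c, hc⟩ := Int.modEq_iff_dvd.mp hk1.symm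
    obtain ⟨m', hm'⟩ : ∃ m', m = m' + 1 := ⟨m - 1, by omega⟩
    refine ⟨(N : ℤ) * h, -(c * (q : ℤ) ^ m'), ?_⟩
    rw [hm', pow_succ] at hc
    linear_combination hc
  have hkq : Nat.Coprime k q := Nat.isCoprime_iff_coprime.mp hkq'
  have hNk : IsCoprime ((N * k : ℕ) : ℤ) (q : ℤ) := by
    push_cast; exact IsCoprime.mul_left hNq hkq'
  obtain ⟨ρ, v, hρv⟩ := (IsCoprime.pow_right hNk : IsCoprime ((N * k : ℕ) : ℤ) ((q : ℤ) ^ (E + Nat.totient (N * k) * s)))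
  have hρL : ((N * k : ℕ) : ℤ) * ρ ≡ 1 [ZMOD (q : ℤ) ^ (E + Nat.totient (N * k) * s)] := by
    rw [Int.modEq_iff_dvd]; exact ⟨v, by linear_combination -hρv⟩
  have hρQ : ((N * k : ℕ) : ℤ) * ρ ≡ 1 [ZMOD (q : ℤ) ^ m] :=
    Int.ModEq.of_dvd (pow_dvd_pow _ (le_trans (min_le_left E s) (Nat.le_add_right E _))) hρL
  refine ⟨k, ρ, hk0, hkq, hρL, hρQ, ?_⟩
  -- `ρ ≡ h`: both are inverses of `Nk`
  have h1 : ((N * k : ℕ) : ℤ) * ρ ≡ ((N * k : ℕ) : ℤ) * h [ZMOD (q : ℤ) ^ m] := by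
    refine hρQ.trans ?_
    have : ((N * k : ℕ) : ℤ) * h = (N : ℤ) * h * k := by push_cast; ring
    rw [this]; exact hk1.symm
  obtain ⟨c, hc⟩ := Int.modEq_iff_dvd.mp h1
  have hdvd : (q : ℤ) ^ m ∣ (h - ρ) * ((N * k : ℕ) : ℤ) := ⟨c, by linear_combination hc⟩
  have hQNk : IsCoprime ((q : ℤ) ^ m) ((N * k : ℕ) : ℤ) := IsCoprime.pow_left hNk.symm
  exact Int.modEq_iff_dvd.mpr (hQNk.dvd_of_dvd_mul_right hdvd)

/-- For a prime `q`: `IsCoprime x q ↔ q ∤ x`. -/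
theorem isCoprime_iff_not_dvd_of_prime (hq : q.Prime) (x : ℤ) : IsCoprime x (q : ℤ) ↔ ¬ (q : ℤ) ∣ x := by
  rw [isCoprime_comm]
  exact (Nat.prime_iff_prime_int.mp hq).coprime_iff_not_dvd

/-- KEY(e+1): invariance of level `e+1` under `h ↦ h′`, `h′ ≡ h (mod q)`, `q² ∤ h′ − h`, from class-independence at level `e`. -/
theorem tv_key (hq : q.Prime) (hqN : Nat.Coprime q N) (hs : 1 ≤ s)
    (level0 : ∀ r, g 0 r = 0)
    (period : ∀ n r, g n (r + (q : ℤ) ^ n) = g n r)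
    (unreduce : ∀ n r, g (n + 1) ((q : ℤ) * r) = g n r)
    (hres : ∀ (n : ℕ) (r t : ℤ), s ≤ n → IsCoprime r (q : ℤ) → g n (r + t * (q : ℤ) ^ s) = g n r)
    (hMHint : ∀ (γ : SL(2, ℤ)) (k e L : ℕ), 0 < k → Nat.Coprime k q → 1 ≤ e → e + Nat.totient (N * k) * s ≤ L →
      ∀ ρ : ℤ, ((N * k : ℕ) : ℤ) * ρ ≡ 1 [ZMOD (q : ℤ) ^ L] →
      (γ : Matrix (Fin 2) (Fin 2) ℤ) 1 0 = ((N * q ^ e * k : ℕ) : ℤ) →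
      (γ : Matrix (Fin 2) (Fin 2) ℤ) 1 1 ≡ 1 [ZMOD ((N * k : ℕ) : ℤ)] →
      ∀ x y : ℤ, ((N * k : ℕ) : ℤ) * x = 1 - (γ : Matrix (Fin 2) (Fin 2) ℤ) 1 1 →
        ((N * k : ℕ) : ℤ) * y = (γ : Matrix (Fin 2) (Fin 2) ℤ) 0 0 - 1 →
        g e ρ - g e ((γ : Matrix (Fin 2) (Fin 2) ℤ) 1 1 * ρ) = g e y - g e x)
    (e : ℕ) (hIH : ∀ r r' : ℤ, IsCoprime r (q : ℤ) → IsCoprime r' (q : ℤ) → g e r = g e r')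
    {h h' : ℤ} (hh : IsCoprime h (q : ℤ)) (hdvd : (q : ℤ) ∣ h' - h) (hndvd : ¬ (q : ℤ) ^ 2 ∣ h' - h) :
    g (e + 1) h' = g (e + 1) h := by
  obtain ⟨u, hu⟩ := hdvd
  have huq : IsCoprime u (q : ℤ) := by
    rw [isCoprime_iff_not_dvd_of_prime hq]
    rintro ⟨w, hw⟩
    exact hndvd ⟨w, by rw [hu, hw]; ring⟩
  have hh' : IsCoprime h' (q : ℤ) := by
    rw [show h' = h + u * (q : ℤ) by linear_combination hu]
    exact hh.add_mul_right_left _  -- IsCoprime (h + u * q) q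
  have hm : 1 ≤ min (e + 1) s := le_min (by omega) hs
  obtain ⟨k, ρ, hk0, hkq, hρL, hρQ, hρh⟩ := tv_exists_hub (s := s) hq hqN (e + 1) hm hh
  -- the deep row with `z = q u`
  have hDq : IsCoprime (1 + ((N * k : ℕ) : ℤ) * ((q : ℤ) * u)) (q : ℤ) :=
    ⟨1, -(((N * k : ℕ) : ℤ) * u), by ring⟩
  obtain ⟨A, B, hdet, hEQ⟩ := tv_deepRow (s := s) hMHint hk0 hkq (by omega : 1 ≤ e + 1) hDq hρL
  -- the right side vanishes (level `e`)
  have hA : IsCoprime A (q : ℤ) := by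
    refine ⟨1 + ((N * k : ℕ) : ℤ) * ((q : ℤ) * u), -(B * ((N * q ^ e * k : ℕ) : ℤ)), ?_⟩
    have : ((N * q ^ (e + 1) * k : ℕ) : ℤ) = ((N * q ^ e * k : ℕ) : ℤ) * (q : ℤ) := by push_cast; ring
    rw [this] at hdet
    linear_combination hdet
  have hRHS : g (e + 1) (-A * ((q : ℤ) * u) + B * (q : ℤ) ^ (e + 1)) - g (e + 1) (-((q : ℤ) * u)) = 0 := by
    rw [show -A * ((q : ℤ) * u) + B * (q : ℤ) ^ (e + 1) = (q : ℤ) * (-A * u + B * (q : ℤ) ^ e) by ring,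
      show -((q : ℤ) * u) = (q : ℤ) * (-u) by ring, unreduce, unreduce]
    rcases Nat.eq_zero_or_pos e with he0 | he0
    · subst he0; rw [level0, level0, sub_self]
    · rw [sub_eq_zero]
      refine hIH _ _ ?_ huq.neg_left
      rw [isCoprime_iff_not_dvd_of_prime hq]
      intro hdiv
      have h1 : (q : ℤ) ∣ B * (q : ℤ) ^ e := by
        obtain ⟨e', rfl⟩ : ∃ e', e = e' + 1 := ⟨e - 1, by omega⟩
        exact ⟨B * (q : ℤ) ^ e', by ring⟩
      have h2 : (q : ℤ) ∣ A * u := by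
        have := dvd_sub hdiv h1
        rw [show -A * u + B * (q : ℤ) ^ e - B * (q : ℤ) ^ e = -(A * u) by ring] at this
        exact (dvd_neg.mp this)
      rcases (Nat.prime_iff_prime_int.mp hq).dvd_or_dvd h2 with h3 | h3
      · exact (isCoprime_iff_not_dvd_of_prime hq A).mp hA h3
      · exact (isCoprime_iff_not_dvd_of_prime hq u).mp huq h3
  rw [hRHS, sub_eq_zero] at hEQ
  -- `ρ ≡ h`, `Dρ ≡ h′`
  have h1 : g (e + 1) ρ = g (e + 1) h := tv_res_of_modEq period hres (e + 1) hh hρh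
  have h2 : g (e + 1) ((1 + ((N * k : ℕ) : ℤ) * ((q : ℤ) * u)) * ρ) = g (e + 1) h' := by
    refine tv_res_of_modEq period hres (e + 1) hh' ?_
    have h3 : (1 + ((N * k : ℕ) : ℤ) * ((q : ℤ) * u)) * ρ = ρ + ((q : ℤ) * u) * (((N * k : ℕ) : ℤ) * ρ) := by ring
    rw [h3, show h' = h + ((q : ℤ) * u) * 1 by linear_combination hu]
    exact Int.ModEq.add hρh (Int.ModEq.mul_left _ hρQ)
  rw [← h1, ← h2, hEQ]

/-- From KEY: level `e+1` depends only on the residue mod `q` (on units). -/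
theorem tv_modq (hq : q.Prime) {e : ℕ}
    (hkey : ∀ h h' : ℤ, IsCoprime h (q : ℤ) → (q : ℤ) ∣ h' - h → ¬ (q : ℤ) ^ 2 ∣ h' - h → g (e + 1) h' = g (e + 1) h)
    {h h' : ℤ} (hh : IsCoprime h (q : ℤ)) (hdvd : (q : ℤ) ∣ h' - h) : g (e + 1) h' = g (e + 1) h := by
  by_cases h2 : (q : ℤ) ^ 2 ∣ h' - h
  · -- detour through `h″ = h + q h`
    have hqh : ¬ (q : ℤ) ^ 2 ∣ (h + (q : ℤ) * h) - h := by
      rw [show h + (q : ℤ) * h - h = (q : ℤ) * h by ring, pow_two]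
      intro hd
      have := (mul_dvd_mul_iff_left (by exact_mod_cast hq.ne_zero : (q : ℤ) ≠ 0)).mp hd
      exact (isCoprime_iff_not_dvd_of_prime hq h).mp hh this
    have hstep1 := hkey h (h + (q : ℤ) * h) hh ⟨h, by ring⟩ hqh
    have hh'' : IsCoprime (h + (q : ℤ) * h) (q : ℤ) := by
      rw [show h + (q : ℤ) * h = h + h * (q : ℤ) by ring]; exact hh.add_mul_right_left _
    have hstep2 := hkey (h + (q : ℤ) * h) h' hh'' (by
        rw [show h' - (h + (q : ℤ) * h) = (h' - h) - (q : ℤ) * h by ring]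
        exact dvd_sub hdvd ⟨h, rfl⟩) (by
        rw [show h' - (h + (q : ℤ) * h) = (h' - h) - (q : ℤ) * h by ring]
        intro hd
        exact hqh (by
          rw [show h + (q : ℤ) * h - h = (h' - h) - ((h' - h) - (q : ℤ) * h) by ring]
          exact dvd_sub h2 hd))
    rw [hstep2, hstep1]
  · exact hkey h h' hh hdvd h2

end ClassIndep

end Summit.BirchSwinnertonDyer.BirchSwinnertonDyer.Theorems.ManinLocalTwoThree
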